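import Summits.KontsevichZagierPeriods.KontsevichZagierPeriods.Theorems.KzOnePeriodsLadder
import Summits.KontsevichZagierPeriods.KontsevichZagierPeriods.Theorems.SymplecticScissorsPlanarTransport
import Summits.KontsevichZagierPeriods.KontsevichZagierPeriods.Theorems.AbelContractionAreasToArcs
import Summits.KontsevichZagierPeriods.KontsevichZagierPeriods.Theorems.LowDimensionLowdimDimZero
import Summits.KontsevichZagierPeriods.KontsevichZagierPeriods.Theorems.LowDimensionLowdimBaker0DimLeOne
import Literature.NumberTheory.Transcendental.HuberWustholz2022.MainTheorems
import Literature.NumberTheory.Transcendental.CurvePeriods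

/-!
# KontsevichZagierPeriods — status of the dimension ladder through rung 1, and the named gaps

Cell pub-kz1p (KZ 1-periods), seat b2b-kz1p-1 (LEAN-IN-TREE migration of the staging package's `Rung1OfPlanarAreas.lean` and
`Gaps.lean`).  This file WIRES the landed tree theorems into the ladder vocabulary of `KzOnePeriodsLadder.lean` and records, as
explicit hypotheses of theorems (no new `Prop` constants), what separates them from "Huber–Wüstholz ⇒ KZ_≤1".  Nothing here is a new piece of
mathematics; the point is that the division "kernel theorem / hypothesis / open" is itself kernel-checked and citable by name.

STATUS (all sorry-free, standard axioms; `ladder_status` bundles it):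
* rung 0 — `KZ_le_zero : KZ_le 0` — PROVED (item stmt-KontsevichZagierPeriods-0119 `LowDimension.LowdimDimZero`,
  `lowdimDimZero_proof`);
* rational rung 1 — `KZ_leRat_one : KZ_leRat 1` — PROVED (item stmt-…-10622 `LowDimension.LowdimBaker0DimLeOne`, from Baker /
  the Hurwitz-micro-sector normal form, `lowdimBaker0DimLeOne_proof`);
* rung 1, all ℚ-semialgebraic representations — `KZ_le_one_of_planarAreas : LowDimension.PlanarAreas → KZ_le 1` — PROVED
  reduction inside the calculus ("areas to arcs", item stmt-…-0117, + the slab lift); and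
  `KZ_le_one_of_huberWustholzCurvePeriods : HuberWustholzCurvePeriods → KZ_le 1` — PROVED from the tree's RENDERING of
  [HW, Thm 13.3(2) p. 121] (a NAMED FACT used as a hypothesis, never asserted), as the COMPOSITION through the station
  `LowDimension.PlanarAreas`: `SymplecticScissors.PlanarTransport.planarAreas_of_huberWustholzCurvePeriods` (rendering ⇒
  PlanarAreas — the cell's former hypothesis G0, a theorem) then `KZ_le_one_of_planarAreas`; the same composition was landed
  first, written out without the ladder vocabulary, as `kz_le_one_of_huberWustholzCurvePeriods`
  (`Theorems/KzOnePeriodsRungOneOfHW.lean`);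
* `LowDimension.PlanarAreas` itself (item stmt-…-4990, "Hilbert's third problem for planar ℚ-semialgebraic sets inside the
  rules") — OPEN unconditionally; it is exactly the station where a Huber–Wüstholz-type theorem is transferred into the moves.

NAMED GAPS (hypotheses only; cell GAPS.md):
* **G-D1** — the hypothesis `HW_Thm13_3_2 D → HuberWustholzCurvePeriods` — the ONLY distance between the PRINTED theorem
  [HW, Thm 13.3(2)] (typed verbatim-schematically over posited realisation data `D : HWData`,
  `Literature/…/HuberWustholz2022/MainTheorems.lean`) and the tree's elementary rendering (embedded smooth affine curves
  `{F₁ = ⋯ = F_m = 0} ⊂ ℂⁿ`, polynomial 1-forms with algebraic coefficients, `C¹` paths with algebraic endpoints, relator list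
  `CurvePeriods.IsElementaryRelation`; deltas recorded word by word in the cell's DIVERGENCE.md D-1).  Meaningful only for the
  intended instance of `D` (definition request G4: 1-motives / pairs `(C, D)` with their realisations, not constructible from
  Mathlib today); for a degenerate `D` it may hold or fail vacuously — it is a placeholder for a construction, not a claim.
* **G-LE1** — the statement `KZ_leLE 1` — the TRUNCATED rung: equal values ⇒ equivalent by moves AMONG representations of
  dimension `≤ 1` (`KZ.EquivalentLE 1`).  Not implied by any landed theorem (every known realisation of the curve relators uses
  2-dimensional bands); its transfer form is the hypothesis `TransferDatum curvePeriodStructure (relationsLE 1) 1` of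
  `KzOnePeriodsTransferSchema.lean`.  PLACEMENT (landed 2026-08-19, `Theorems/KzOnePeriodsLadderLE.lean`, which imports only
  the truncated-ladder kits and not this file): the truncated rung 0 `KZ_leLE 0` is PROVED (`KZ_leLE_zero`), and
  `KZ_leLE 1 ↔ ¬ DessinsDimensionOne.DimOneNeedsExcursion` (`KZ_leLE_one_iff_not_dimOneNeedsExcursion`) — so G-LE1 is exactly the
  NEGATION of the open route item stmt-KontsevichZagierPeriods-6266, which two routes bet is TRUE (i.e. that G-LE1 fails:
  `not_KZ_leLE_one_of_cauchyGenusTwoNotDimOne` from witness item 6260, `not_KZ_leLE_one_of_dimOneNotConservative` from crux 3749);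
  between `KZ_leLE 1` and `KZ_le 1` sits the budget-2 statement `DessinsDimensionOne.DimLeOneBudgetTwo` (item 6261:
  `dimLeOneBudgetTwo_of_KZ_leLE_one`, `KZ_le_one_of_dimLeOneBudgetTwo`).  G-LE1 is therefore not a target of this cell.

References: [KZ] M. Kontsevich, D. Zagier, *Periods* (2001), §1.1–1.2; [HW] A. Huber, G. Wüstholz, *Transcendence and Linear
Relations of 1-Periods*, Cambridge Tracts 227 (2022), Thm 13.3 p. 121.
[cite: KontsevichZagier2001, §1.2] [cite: HuberWustholz2022, Thm 13.3 p.121]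
-/

noncomputable section

namespace Summit.KontsevichZagierPeriods.KzOnePeriods

open Literature.NumberTheory.Transcendental
open Literature.NumberTheory.Transcendental.KZ
open Literature.NumberTheory.Transcendental.HuberWustholz2022
open Summit.KontsevichZagierPeriods.KontsevichZagierPeriods.Theses

/-! ### The proved rungs, in ladder vocabulary -/

/-- **Rung 0 is a theorem**: `KZ_le 0` (item stmt-KontsevichZagierPeriods-0119, `lowdimDimZero_proof`). -/
theorem KZ_le_zero : KZ_le 0 :=
  lowdimDimZero_iff_KZ_le_zero.1 Summit.KontsevichZagierPeriods.LowDimension.LowdimDimZero.lowdimDimZero_proof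

/-- **The rational-shape rung 1 is a theorem**: `KZ_leRat 1` (item stmt-KontsevichZagierPeriods-10622,
`lowdimBaker0DimLeOne_proof`; definitionally the same statement). -/
theorem KZ_leRat_one : KZ_leRat 1 :=
  lowdimBaker0DimLeOne_iff_KZ_leRat_one.1
    Summit.KontsevichZagierPeriods.LowDimension.LowdimBaker0DimLeOne.lowdimBaker0DimLeOne_proof

/-- Rung 1 is decided in dimension exactly 1: `KZ_le 1` iff any two 1-dimensional representations with equal values are
equivalent (dimension 0 is raised to 1 by a slab, KZ rule (3): `IntegralRep.exists_equivalent_of_le`). -/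
theorem KZ_le_one_iff_dim_one :
    KZ_le 1 ↔ ∀ (r r' : IntegralRep 1), r.value = r'.value → Equivalent r r' := by
  refine ⟨fun h r r' hv => h le_rfl le_rfl r r' hv, fun h n m hn hm r r' hv => ?_⟩
  obtain ⟨R, hR⟩ := r.exists_equivalent_of_le hn
  obtain ⟨R', hR'⟩ := r'.exists_equivalent_of_le hm
  have hvR : R.value = R'.value := by
    rw [← Equivalent.value_eq_holds hR, ← Equivalent.value_eq_holds hR', hv]
  exact (hR.trans (h R R' hvR)).trans hR'.symm

/-- **Rung 1 from planar areas** (unconditional reduction inside the calculus): `PlanarAreas → KZ_≤1` for ALL ℚ-semialgebraic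
representations of dimensions `≤ 1` — "areas to arcs" (item stmt-KontsevichZagierPeriods-0117,
`AbelContraction.AreasToArcs.equivalent_of_value_eq_of_planarAreas`: graph/undergraph bands by Newton–Leibniz, gluing by domain
additivity) after the slab lift.  Together with `planarAreas_of_KZ_le_two`: `KZ_le 2 → PlanarAreas → KZ_le 1`. -/
theorem KZ_le_one_of_planarAreas (hP : LowDimension.PlanarAreas) : KZ_le 1 :=
  KZ_le_one_iff_dim_one.2
    (Summit.KontsevichZagierPeriods.AbelContraction.AreasToArcs.equivalent_of_value_eq_of_planarAreas hP)

/-- **Rung 1 from the tree's rendering of Huber–Wüstholz**, in ladder vocabulary, as the composition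
rendering ⇒ `PlanarAreas` (landed route theorem `SymplecticScissors.PlanarTransport.planarAreas_of_huberWustholzCurvePeriods`:
normalisation Θ, planar transport, K₀-injectivity — the cell's former hypothesis "G0", a theorem) ⇒ `KZ_le 1`
(`KZ_le_one_of_planarAreas`: "areas to arcs" + slab lift).  The NAMED FACT
`HuberWustholzCurvePeriods` — the elementary rendering of [HW, Thm 13.3(2) p. 121] — is a hypothesis, never asserted.  (The same
composition, written out without `KZ_le`, was landed first as `KzOnePeriods.kz_le_one_of_huberWustholzCurvePeriods`,
`Theorems/KzOnePeriodsRungOneOfHW.lean`.) -/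
theorem KZ_le_one_of_huberWustholzCurvePeriods (hHW : HuberWustholzCurvePeriods) : KZ_le 1 :=
  KZ_le_one_of_planarAreas
    (Summit.KontsevichZagierPeriods.SymplecticScissors.PlanarTransport.planarAreas_of_huberWustholzCurvePeriods hHW)

/-- The rendering also gives the rational rung (which is unconditionally a theorem anyway, `KZ_leRat_one`). -/
theorem KZ_leRat_one_of_huberWustholzCurvePeriods (hHW : HuberWustholzCurvePeriods) : KZ_leRat 1 :=
  KZ_leRat_of_KZ_le (KZ_le_one_of_huberWustholzCurvePeriods hHW)

/-! ### The named gaps (as explicit hypotheses; no new `Prop` constants) -/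

/-- Rung 1 from the VERBATIM-SCHEMATIC Huber–Wüstholz Theorem 13.3(2) over posited realisation data `D`, given **gap G-D1**
for `D` — the transfer of vocabularies `HW_Thm13_3_2 D → HuberWustholzCurvePeriods` (cell DIVERGENCE.md D-1; a CONSTRUCTION,
definition request G4, open; for degenerate `D` it carries no content), taken as an explicit hypothesis.
[cite: HuberWustholz2022, Thm 13.3(2) p.121] -/
theorem KZ_le_one_of_HW_Thm13_3_2_of_gapD1 (D : HWData) (hD1 : HW_Thm13_3_2 D → HuberWustholzCurvePeriods)
    (hHW : HW_Thm13_3_2 D) : KZ_le 1 :=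
  KZ_le_one_of_huberWustholzCurvePeriods (hD1 hHW)

/-- The full [HW, Thm 13.3] (conjunction of its three clauses) over `D`, given gap G-D1 for `D`, gives rung 1.
[cite: HuberWustholz2022, Thm 13.3 p.121] -/
theorem KZ_le_one_of_HW_Thm13_3_of_gapD1 (D : HWData) (hD1 : HW_Thm13_3_2 D → HuberWustholzCurvePeriods)
    (hHW : HW_Thm13_3 D) : KZ_le 1 :=
  KZ_le_one_of_HW_Thm13_3_2_of_gapD1 D hD1 hHW.2.1

/-- **Gap G-LE1** is the truncated rung `KZ_leLE 1` itself (open; cell referee R1-6): equal values in dimensions `≤ 1` ⇒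
equivalent by moves among representations of dimension `≤ 1` only.  It is at least as strong as the full-calculus rung 1
(`KZ_le_of_KZ_leLE`); recorded in ladder vocabulary. [cite: KontsevichZagier2001, §1.2] -/
theorem KZ_le_one_of_KZ_leLE_one (h : KZ_leLE 1) : KZ_le 1 :=
  KZ_le_of_KZ_leLE h

/-! ### Summary -/

/-- **Ladder status through rung 1** (2026-08-19): rung 0 and the rational rung 1 are theorems; rung 1 for all
ℚ-semialgebraic representations is a theorem relative to `PlanarAreas` (open crux, item 4990); the rendering
`HuberWustholzCurvePeriods` of Huber–Wüstholz (named fact, hypothesis) gives `PlanarAreas` and hence rung 1; `KZ_le 2` gives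
`PlanarAreas` back; the summit is the conjunction of all rungs.
[cite: KontsevichZagier2001, §1.2] -/
theorem ladder_status :
    KZ_le 0 ∧ KZ_leRat 1 ∧ (LowDimension.PlanarAreas → KZ_le 1) ∧ (HuberWustholzCurvePeriods → LowDimension.PlanarAreas) ∧
      (HuberWustholzCurvePeriods → KZ_le 1) ∧ (KZ_le 2 → LowDimension.PlanarAreas) ∧
      (_root_.KontsevichZagierPeriods ↔ ∀ d, KZ_le d) :=
  ⟨KZ_le_zero, KZ_leRat_one, KZ_le_one_of_planarAreas,
    Summit.KontsevichZagierPeriods.SymplecticScissors.PlanarTransport.planarAreas_of_huberWustholzCurvePeriods,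
    KZ_le_one_of_huberWustholzCurvePeriods, planarAreas_of_KZ_le_two, summit_iff_forall_KZ_le⟩

end Summit.KontsevichZagierPeriods.KzOnePeriods
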